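import Literature.AnabelianGeometry.SemiGraphs.PSCRamificationSplitInjection
import Literature.AnabelianGeometry.SemiGraphs.PSCVertexQuotientConverseProofs
import Literature.AnabelianGeometry.SemiGraphs.PrimeExponentComplement
import Mathlib.Topology.Algebra.ClopenNhdofOne
import Mathlib.Topology.Algebra.Group.Pointwise
import Mathlib.Tactic.Group
import HarnessLib

/-!
# [IUTchI] Rmk. 1.2.3 (iv) body (VQ), converse half, over the CORRECTED split injection `UnrVerticialSplitInjection'`

Mochizuki, *Inter-universal Teichmüller theory I* [IUTchI], Remark 1.2.3 (iv), kurims manuscript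
p. 42: "the elementary abelian quotients `φ : M^unr_G ↠ Q` whose restriction to `M^unr-vert_G`
surjects onto `Q` and has the same kernel as the quotient `M^unr-vert_G ↠ M^unr_G[v] ↠ M^unr_G[v] ⊗ F_l`
… may be characterized as the maximal quotients … among those elementary abelian quotients of `M^unr_G`
that correspond to verticially purely totally ramified coverings of `G`."

SUCCESSOR MIGRATION (abc-iut cell, finding F-L3t4g5-1; companion of `PSCVertexQuotientPrimeProofs.lean`).
abc-iut-w4-d052's converse half `vertexQuotientCharacterization_mpr` (`PSCVertexQuotientConverseProofs.lean`,
row T16-L13 of `plan/L3/SUBDAG-CombGC-Thm16.md`) takes the frozen split injection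
`UnrVerticialSplitInjection` (FACT row F-1938, REFUTED as typed at one-vertex data) but uses ONLY its
complement clause.  This proof-only file re-proves it with the COMPLEMENT `C` of `M^unr-vert_G` as
explicit data (`vertexQuotientCharacterization_mpr_of_complement`, proof = d052's verbatim) and derives
the converse half over the successor `UnrVerticialSplitInjection'` (`PSCRamificationSplitInjection.lean`,
abc-iut-L3-t4): `vertexQuotientCharacterization_mpr'` — for EVERY datum, one-vertex data included (the
successor's complement clause is stated against `E ⊔ ⨆_w M^unr_G[w]`, equal to `⨆_w M^unr_G[w]` since the
ramified vertex `v` is in hand, `unrAbKer_sup_iSup_eq`).  The assembled row (both halves,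
`vertexQuotientCharacterization_of_inputs'`) is in `PSCThm16iiiAssemblyPrimeProofs.lean`.

Proof-only (0 defs); plain profinite group theory over the interface; a FACT row is an assumption label;
nothing here takes a side on [IUTchIII] Cor. 3.12. [cite: Mochizuki2012, IUTchI Rmk 1.2.3(iv) p.42]
[cite: MochizukiCombGC2007, Thm 1.6(iii) p.14]
-/

noncomputable section

namespace Literature.AnabelianGeometry.SemiGraphs

namespace PSCDatum

open scoped Pointwise

universe u

variable {P : Type u} [Group P] [TopologicalSpace P] [IsTopologicalGroup P]

section Converse

variable [CompactSpace P] [TotallyDisconnectedSpace P]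

/-- **Row T16-L13, converse implication of `PSCDatum.VertexQuotientCharacterization`, from a COMPLEMENT
of `M^unr-vert_G`** ([IUTchI] Rmk. 1.2.3 (iv), p. 42): for sturdy `G` of pro-`Σ` PSC-type on a profinite
group, `Σ = {l}`, granted the criterion `ElementaryQuotientVerticiallyRamifiedIff` and a closed `C`
with `C ∩ M^unr-vert = E`, `C · M^unr-vert = Π_G` (preimages), an elementary abelian quotient of
`M^unr_G` which corresponds to a verticially purely totally ramified covering and is MAXIMAL among such
restricts to `M^unr-vert_G` onto, with kernel `Ker(M^unr-vert_G ↠ M^unr_G[v] ⊗ F_l)` for the vertex `v`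
over which it ramifies.  (abc-iut-w4-d052's `vertexQuotientCharacterization_mpr`, its complement made a
parameter.) [cite: Mochizuki2012, IUTchI Rmk 1.2.3(iv) p.42] -/
theorem vertexQuotientCharacterization_mpr_of_complement (G : PSCDatum P)
    (hiff : G.ElementaryQuotientVerticiallyRamifiedIff)
    {C : Subgroup P} (hCc : IsClosed (C : Set P))
    (hCA : C ⊓ G.unrVertAb = G.unrAbKer) (hCsup : C ⊔ G.unrVertAb = ⊤)
    (hGs : G.IsSturdy) {l : ℕ} (hS : G.Sigma = {l})
    {H' : Subgroup P} (hH' : G.IsElemAbUnrQuotient l H')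
    (hram : G.IsVerticiallyPurelyTotallyRamified ⊤ H')
    (hmax : ∀ H'' : Subgroup P, G.IsElemAbUnrQuotient l H'' →
      G.IsVerticiallyPurelyTotallyRamified ⊤ H'' → H'' ≤ H' → H'' = H') :
    ∃ v : G.graph.V, G.unrVertAb ⊔ H' = ⊤ ∧ G.unrVertAb ⊓ H' = G.vertexQuotientKer l v := by
  have hl : l.Prime := G.sigma_prime l (by rw [hS]; exact Set.mem_singleton l)
  obtain ⟨hnorm, hopen, hEH, hpow⟩ := hH'
  haveI := hnorm
  obtain ⟨v, hvsup, hvw⟩ := (hiff hGs l H' hS hnorm hopen hEH hpow).mp hram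
  set A : Subgroup P := G.unrVertAb with hA
  set K : Subgroup P := G.vertexQuotientKer l v with hK
  set E : Subgroup P := G.unrAbKer with hE
  have hsup : A ⊔ H' = ⊤ :=
    top_le_iff.mp (hvsup.ge.trans (sup_le_sup_right
      ((G.vertGp_le_unrVertAbOf v).trans (G.unrVertAbOf_le_unrVertAb v)) _))
  refine ⟨v, hsup, ?_⟩
  have hKA : K ≤ A := G.vertexQuotientKer_le_unrVertAb l v
  have hKH : K ≤ H' := G.vertexQuotientKer_le_of_isElemAbUnrQuotient ⟨hnorm, hopen, hEH, hpow⟩ hvw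
  refine le_antisymm ?_ (le_inf hKA hKH)
  by_contra hnot
  rw [SetLike.le_def] at hnot
  push Not at hnot
  obtain ⟨x, hxAH, hxK⟩ := hnot
  obtain ⟨hxA, hxH⟩ := Subgroup.mem_inf.mp hxAH
  have hKc : IsClosed (K : Set P) := G.isClosed_vertexQuotientKer l v
  have hAc : IsClosed (A : Set P) := Subgroup.isClosed_topologicalClosure _
  have hH'c : IsClosed (H' : Set P) := Subgroup.isClosed_of_isOpen _ hopen
  have hcommE : ⁅(⊤ : Subgroup P), ⊤⁆ ≤ E := G.commutator_le_unrAbKer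
  have hEK : E ≤ K := G.unrAbKer_le_vertexQuotientKer l v
  have hEA : E ≤ A := (G.unrAbKer_le_unrVertAbOf v).trans (G.unrVertAbOf_le_unrVertAb v)
  haveI hKn : K.Normal := normal_of_commutator_le (hcommE.trans hEK)
  haveI hAn : A.Normal := normal_of_commutator_le (hcommE.trans hEA)
  have hO : IsOpen ({u : P | u * x⁻¹ ∈ (K : Set P)ᶜ} ∩ (H' : Set P)) :=
    (hKc.isOpen_compl.preimage (continuous_id.mul continuous_const)).inter hopen
  obtain ⟨U₀, hU₀⟩ := ProfiniteGrp.exist_openNormalSubgroup_sub_open_nhds_of_one hO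
    ⟨by simpa using hxK, one_mem H'⟩
  set U : Subgroup P := (U₀ : Subgroup P) with hU
  have hUo : IsOpen (U : Set P) := U₀.isOpen
  have hUH : U ≤ H' := fun u hu => (hU₀ hu).2
  have hUx : ∀ u ∈ U, u * x⁻¹ ∉ K := fun u hu => (hU₀ hu).1
  set K' : Subgroup P := K ⊔ (A ⊓ U) with hK'
  set W : Subgroup P := C ⊓ H' with hW
  set N : Subgroup P := K' ⊔ W with hN
  have hK'A : K' ≤ A := sup_le hKA inf_le_left
  have hK'H : K' ≤ H' := sup_le hKH (inf_le_right.trans hUH)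
  have hxK' : x ∉ K' := by
    intro hx
    have hx' : x ∈ ((K ⊔ U : Subgroup P) : Set P) := (sup_le_sup_left inf_le_right K : K' ≤ K ⊔ U) hx
    rw [Subgroup.mul_normal] at hx'
    obtain ⟨k, hk, u, hu, hux⟩ := hx'
    apply hUx u hu
    have hux' : u * x⁻¹ = k⁻¹ := by rw [← hux]; group
    rw [hux']
    exact inv_mem hk
  have hEK' : E ≤ K' := hEK.trans le_sup_left
  have hKN : K ≤ N := le_sup_left.trans le_sup_left
  have hEN : E ≤ N := hEK'.trans le_sup_left
  have hcommN : ⁅(⊤ : Subgroup P), ⊤⁆ ≤ N := hcommE.trans hEN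
  haveI hNn : N.Normal := normal_of_commutator_le hcommN
  haveI hK'n : K'.Normal := normal_of_commutator_le (hcommE.trans hEK')
  have hNH : N ≤ H' := sup_le hK'H inf_le_right
  have hpowN : ∀ g : P, g ^ l ∈ N := by
    intro g
    have hg : g ∈ ((C ⊔ A : Subgroup P) : Set P) := by rw [hCsup]; exact Subgroup.mem_top g
    rw [Subgroup.mul_normal] at hg
    obtain ⟨c, hc, a, ha, rfl⟩ := hg
    refine PrimeExponent.mul_pow_mem_of_commutator_le hcommN l ?_ ?_
    · exact Subgroup.mem_sup_right ⟨pow_mem hc l, hpow c⟩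
    · exact hKN (G.pow_mem_vertexQuotientKer l v ha)
  have hAN : A ⊓ N ≤ K' := by
    rintro y ⟨hyA, hyN⟩
    have hy : y ∈ ((K' ⊔ W : Subgroup P) : Set P) := hyN
    rw [Subgroup.normal_mul] at hy
    obtain ⟨k, hk, w, hw, rfl⟩ := hy
    have hwA : w ∈ A := by
      have := mul_mem (inv_mem (hK'A hk)) hyA
      rwa [inv_mul_cancel_left] at this
    have hwE : w ∈ E := by rw [← hCA]; exact ⟨hw.1, hwA⟩
    exact mul_mem hk (hEK' hwE)
  have hUc : IsClosed (U : Set P) := Subgroup.isClosed_of_isOpen _ hUo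
  have hK'c : IsClosed (K' : Set P) := isClosed_sup_of_normal_left K (A ⊓ U) hKc (hAc.inter hUc)
  have hWc : IsClosed (W : Set P) := hCc.inter hH'c
  have hNc : IsClosed (N : Set P) := isClosed_sup_of_normal_left K' W hK'c hWc
  haveI hUfi : U.FiniteIndex := finiteIndex_of_isOpen U hUo
  haveI hH'fi : H'.FiniteIndex := finiteIndex_of_isOpen H' hopen
  have h1 : (A ⊓ U).relIndex A ≠ 0 := by
    rw [inf_comm, Subgroup.inf_relIndex_right]
    exact fun h => hUfi.index_ne_zero
      (Nat.eq_zero_of_zero_dvd (h ▸ Subgroup.relIndex_dvd_index_of_normal U A))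
  have h2 : N.relIndex A ≠ 0 := fun h =>
    h1 (Subgroup.relIndex_eq_zero_of_le_left (le_sup_right.trans le_sup_left : A ⊓ U ≤ N) h)
  have h3 : W.relIndex C ≠ 0 := by
    rw [hW, inf_comm, Subgroup.inf_relIndex_right]
    exact fun h => hH'fi.index_ne_zero
      (Nat.eq_zero_of_zero_dvd (h ▸ Subgroup.relIndex_dvd_index_of_normal H' C))
  haveI hAWn : (A ⊔ W).Normal := normal_of_commutator_le (hcommE.trans (hEA.trans le_sup_left))
  have hCAW : C ⊔ (A ⊔ W) = ⊤ :=
    top_le_iff.mp (hCsup.ge.trans (sup_le_sup_left le_sup_left C))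
  have h4 : (A ⊔ W).index ≠ 0 := by
    rw [← Subgroup.relIndex_top_right, ← hCAW, Subgroup.relIndex_sup_right]
    exact fun h => h3 (Subgroup.relIndex_eq_zero_of_le_left le_sup_right h)
  have h5 : N.index ≠ 0 := by
    rw [← Subgroup.relIndex_mul_index (le_sup_right : N ≤ A ⊔ N), Subgroup.relIndex_sup_right]
    refine mul_ne_zero h2 fun h => h4 (Nat.eq_zero_of_zero_dvd ?_)
    exact h ▸ Subgroup.index_dvd_of_le (sup_le_sup_left (le_sup_right : W ≤ N) A)
  haveI : N.FiniteIndex := ⟨h5⟩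
  have hNo : IsOpen (N : Set P) := Subgroup.isOpen_of_isClosed_of_finiteIndex N hNc
  obtain ⟨S, hNS, hSH, hASsup, hASinf⟩ :=
    PrimeExponent.exists_le_sup_eq_top_inf_eq (N := N) (A := A ⊔ N) (H := H') hcommN hl hpowN
      le_sup_right hNH (by rw [sup_assoc, sup_eq_right.mpr hNH, hsup])
  have hSo : IsOpen (S : Set P) := Subgroup.isOpen_mono hNS hNo
  haveI hSn : S.Normal := normal_of_commutator_le (hcommN.trans hNS)
  have hES : E ≤ S := hEN.trans hNS
  have hSel : G.IsElemAbUnrQuotient l S := ⟨hSn, hSo, hES, fun g => hNS (hpowN g)⟩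
  have hSram : G.IsVerticiallyPurelyTotallyRamified ⊤ S := by
    refine (hiff hGs l S hS hSn hSo hES (fun g => hNS (hpowN g))).mpr ⟨v, ?_, fun w hw => ?_⟩
    · refine top_le_iff.mp ?_
      have hVo : IsOpen ((G.vertGp v ⊔ S : Subgroup P) : Set P) :=
        Subgroup.isOpen_mono le_sup_right hSo
      have hA_le : A ≤ G.vertGp v ⊔ S :=
        G.unrVertAb_le_of_forall_vertGp_le hVo (hES.trans le_sup_right) fun w => by
          by_cases hwv : w = v
          · subst hwv; exact le_sup_left
          · exact ((G.vertGp_le_vertexQuotientKer l hwv).trans (hKN.trans hNS)).trans le_sup_right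
      rw [← hASsup]
      exact sup_le (sup_le hA_le (hNS.trans le_sup_right)) le_sup_right
    · exact (G.vertGp_le_vertexQuotientKer l hw).trans (hKN.trans hNS)
  have hSeq : S = H' := hmax S hSel hSram hSH
  have hxN : x ∈ N := by
    rw [← hASinf]
    exact ⟨Subgroup.mem_sup_left hxA, hSeq ▸ hxH⟩
  exact hxK' (hAN ⟨hxA, hxN⟩)

/-- **Row T16-L13, converse implication over the CORRECTED split injection `UnrVerticialSplitInjection'`**
— for EVERY sturdy datum on a profinite group with `Σ = {l}` (one-vertex data included): the
successor's complement clause, stated against `E ⊔ ⨆_w M^unr_G[w]`, is the frozen one because the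
ramified vertex makes the vertex set nonempty (`unrAbKer_sup_iSup_eq`).
[cite: Mochizuki2012, IUTchI Rmk 1.2.3(iv) p.42] -/
theorem vertexQuotientCharacterization_mpr' (G : PSCDatum P)
    (hiff : G.ElementaryQuotientVerticiallyRamifiedIff) (hsplit : G.UnrVerticialSplitInjection')
    (hGs : G.IsSturdy) {l : ℕ} (hS : G.Sigma = {l})
    {H' : Subgroup P} (hH' : G.IsElemAbUnrQuotient l H')
    (hram : G.IsVerticiallyPurelyTotallyRamified ⊤ H')
    (hmax : ∀ H'' : Subgroup P, G.IsElemAbUnrQuotient l H'' →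
      G.IsVerticiallyPurelyTotallyRamified ⊤ H'' → H'' ≤ H' → H'' = H') :
    ∃ v : G.graph.V, G.unrVertAb ⊔ H' = ⊤ ∧ G.unrVertAb ⊓ H' = G.vertexQuotientKer l v := by
  -- a ramified vertex exists, so the vertex set is nonempty and the complement clauses coincide
  obtain ⟨v₀, -, -⟩ :=
    (hiff hGs l H' hS hH'.1 hH'.2.1 hH'.2.2.1 hH'.2.2.2).mp hram
  haveI : Nonempty G.graph.V := ⟨v₀⟩
  obtain ⟨-, C, hCc, -, hCA, hCsup⟩ := hsplit hGs
  rw [G.unrAbKer_sup_iSup_eq] at hCA hCsup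
  exact G.vertexQuotientCharacterization_mpr_of_complement hiff hCc hCA hCsup hGs hS hH' hram hmax

end Converse

end PSCDatum

end Literature.AnabelianGeometry.SemiGraphs

end
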